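import Mathlib
import HarnessLib
import Summits.Ventures.LatticeQCDFlow.Scoring.ScalingExponentFit

/-!
# A certificate of misfit for the power-law fit: every annihilator `c` (`Σ c = 0`, `Σ c·x = 0`) gives `χ²(b, z) ≥ (Σ cᵢyᵢ)²/(Σ cᵢ²/wᵢ)` for EVERY line; with three points `Σ cᵢyᵢ = (x₁ − x₀)(x₂ − x₁)(z₁₂ − z₀₁)` — the difference of the consecutive two-point exponents

HONEST FRAMING: exact (Metropolis-corrected) sampling algorithms for lattice gauge theory;
figures of merit are autocorrelation/cost numbers at stated couplings and volumes; no
continuum-physics claim.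

Venture `LatticeQCDFlow` (cell pub-lqcd), sub-topic `Scoring`, FANOUT row 21 (`su3-base`).  Acceptance item (g) of the row
(HOME/su3-base/CARD-su3-base.md §7) fits `τ_int(Q²)` over THREE points (P0, S2, P1) by a power law AND by an exponential law
and reports the two-point exponents of consecutive pairs; row 7's `Scoring/ScalingExponentFit` types the weighted log–log
least-squares fit (`fitChiSq s w x y b z = Σ w (y − b − zx)²`, its closed-form minimiser, `fitChiSq_min`).  This file adds the
MODEL-INDEPENDENT LOWER BOUND on that `χ²` — OUR WORK, finite real algebra over Mathlib and that file; no definition, nothing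
cited as a fact, no number of ours:

* `sum_annihilator_residual` — if `Σᵢ cᵢ = 0` and `Σᵢ cᵢxᵢ = 0` then `Σᵢ cᵢ(yᵢ − b − zxᵢ) = Σᵢ cᵢyᵢ` for every line `(b, z)`;
* **`sq_sum_annihilator_le_mul_fitChiSq`** — Cauchy–Schwarz: `(Σᵢ cᵢyᵢ)² ≤ (Σᵢ cᵢ²/wᵢ) · χ²(b, z)` for EVERY `b, z`
  (positive weights), i.e. **`fitChiSq_ge_annihilator`** — `χ²(b, z) ≥ (Σᵢ cᵢyᵢ)²/(Σᵢ cᵢ²/wᵢ)`: no straight line (no power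
  law in log–log variables) fits the data better than this number, whatever the fitting procedure;
* THREE POINTS (`x₀, x₁, x₂` with ordinates `y₀, y₁, y₂`, weights `wᵢ = 1/σᵢ²`): the annihilator is
  `c = (x₂ − x₁, −(x₂ − x₀), x₁ − x₀)` (`threePoint_annihilator_sum`, `threePoint_annihilator_sum_mul`), and its value on the data
  is **`threePoint_annihilator_eq`** — `Σ cᵢyᵢ = (x₁ − x₀)(x₂ − x₁)(z₁₂ − z₀₁)` with the two-point exponents
  `z₀₁ = (y₁ − y₀)/(x₁ − x₀)`, `z₁₂ = (y₂ − y₁)/(x₂ − x₁)` (distinct abscissae): hence **`threePoint_fitChiSq_ge`** —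
  `χ²(b, z) ≥ (x₁ − x₀)²(x₂ − x₁)²(z₁₂ − z₀₁)² / (c₀²σ₀² + c₁²σ₁² + c₂²σ₂²)` for every line.  For (g): the best power-law `χ²`
  over (P0, S2, P1) is bounded below by the squared DIFFERENCE of the two consecutive two-point exponents in units of its
  propagated error — the quantitative form of "a power law has equal two-point exponents" (row 21's
  `Scaling/ExponentialLawSecantExponent`: an exponential law has strictly increasing ones).
NOT CLAIMED: that the bound is attained (it is, at the least-squares line, for three points — not proved here); anything
statistical about `σᵢ`; which law the row's data follow.
-/

noncomputable section

namespace Summit.Ventures.LatticeQCDFlow.Scoring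

open Finset

section General

variable {ι : Type*} (s : Finset ι) (w x y : ι → ℝ)

/-- **Annihilators kill every line**: `Σ cᵢ(yᵢ − b − zxᵢ) = Σ cᵢyᵢ` when `Σ cᵢ = 0` and `Σ cᵢxᵢ = 0`. -/
theorem sum_annihilator_residual (c : ι → ℝ) (hc0 : ∑ i ∈ s, c i = 0) (hc1 : ∑ i ∈ s, c i * x i = 0)
    (b z : ℝ) : ∑ i ∈ s, c i * (y i - (b + z * x i)) = ∑ i ∈ s, c i * y i := by
  have h : ∀ i ∈ s, c i * (y i - (b + z * x i)) = c i * y i - b * c i - z * (c i * x i) := fun i _ => by ring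
  rw [sum_congr rfl h, sum_sub_distrib, sum_sub_distrib, ← mul_sum, ← mul_sum, hc0, hc1]
  ring

/-- **Cauchy–Schwarz: `(Σ cᵢyᵢ)² ≤ (Σ cᵢ²/wᵢ) · χ²(b, z)`** for every line `(b, z)` and every annihilator `c`
(positive weights). -/
theorem sq_sum_annihilator_le_mul_fitChiSq (hw : ∀ i ∈ s, 0 < w i) (c : ι → ℝ) (hc0 : ∑ i ∈ s, c i = 0)
    (hc1 : ∑ i ∈ s, c i * x i = 0) (b z : ℝ) :
    (∑ i ∈ s, c i * y i) ^ 2 ≤ (∑ i ∈ s, c i ^ 2 / w i) * fitChiSq s w x y b z := by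
  rw [← sum_annihilator_residual s x y c hc0 hc1 b z, fitChiSq]
  refine sum_sq_le_sum_mul_sum_of_sq_le_mul s (fun i hi => div_nonneg (sq_nonneg _) (hw i hi).le)
    (fun i hi => mul_nonneg (hw i hi).le (sq_nonneg _)) (fun i hi => le_of_eq ?_)
  have hwi : w i ≠ 0 := (hw i hi).ne'
  field_simp

/-- **`χ²(b, z) ≥ (Σ cᵢyᵢ)²/(Σ cᵢ²/wᵢ)`** for every line: a model-independent certificate of misfit from any annihilator
with `Σ cᵢ²/wᵢ > 0`. -/
theorem fitChiSq_ge_annihilator (hw : ∀ i ∈ s, 0 < w i) (c : ι → ℝ) (hc0 : ∑ i ∈ s, c i = 0)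
    (hc1 : ∑ i ∈ s, c i * x i = 0) (hV : 0 < ∑ i ∈ s, c i ^ 2 / w i) (b z : ℝ) :
    (∑ i ∈ s, c i * y i) ^ 2 / (∑ i ∈ s, c i ^ 2 / w i) ≤ fitChiSq s w x y b z := by
  rw [div_le_iff₀ hV, mul_comm]
  exact sq_sum_annihilator_le_mul_fitChiSq s w x y hw c hc0 hc1 b z

/-- In particular the LEAST-SQUARES minimum itself obeys the bound. -/
theorem fitChiSq_min_ge_annihilator (hw : ∀ i ∈ s, 0 < w i) (c : ι → ℝ) (hc0 : ∑ i ∈ s, c i = 0)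
    (hc1 : ∑ i ∈ s, c i * x i = 0) (hV : 0 < ∑ i ∈ s, c i ^ 2 / w i) :
    (∑ i ∈ s, c i * y i) ^ 2 / (∑ i ∈ s, c i ^ 2 / w i) ≤
      fitChiSq s w x y (fitIntercept s w x y) (fitSlope s w x y) :=
  fitChiSq_ge_annihilator s w x y hw c hc0 hc1 hV _ _

end General

/-! ## Three points: the annihilator is the second difference, its value the difference of the two-point exponents -/

section Three

variable (w x y : Fin 3 → ℝ)

/-- The three-point annihilator `c = (x₂ − x₁, −(x₂ − x₀), x₁ − x₀)` sums to zero … -/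
theorem threePoint_annihilator_sum : ∑ i, ![x 2 - x 1, -(x 2 - x 0), x 1 - x 0] i = 0 := by
  simp only [Fin.sum_univ_three, Matrix.cons_val_zero, Matrix.cons_val_one, Matrix.cons_val_two, Matrix.head_cons,
    Matrix.tail_cons]
  ring

/-- … and annihilates the abscissae. -/
theorem threePoint_annihilator_sum_mul : ∑ i, ![x 2 - x 1, -(x 2 - x 0), x 1 - x 0] i * x i = 0 := by
  simp only [Fin.sum_univ_three, Matrix.cons_val_zero, Matrix.cons_val_one, Matrix.cons_val_two, Matrix.head_cons,
    Matrix.tail_cons]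
  ring

/-- **Its value on the data is the difference of the consecutive two-point exponents** times the spacings:
`Σ cᵢyᵢ = (x₁ − x₀)(x₂ − x₁)(z₁₂ − z₀₁)`, `z₀₁ = (y₁ − y₀)/(x₁ − x₀)`, `z₁₂ = (y₂ − y₁)/(x₂ − x₁)` (distinct abscissae). -/
theorem threePoint_annihilator_eq (h01 : x 0 ≠ x 1) (h12 : x 1 ≠ x 2) :
    ∑ i, ![x 2 - x 1, -(x 2 - x 0), x 1 - x 0] i * y i =
      (x 1 - x 0) * (x 2 - x 1) * ((y 2 - y 1) / (x 2 - x 1) - (y 1 - y 0) / (x 1 - x 0)) := by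
  have h1 : x 1 - x 0 ≠ 0 := sub_ne_zero.2 (Ne.symm h01)
  have h2 : x 2 - x 1 ≠ 0 := sub_ne_zero.2 (Ne.symm h12)
  simp only [Fin.sum_univ_three, Matrix.cons_val_zero, Matrix.cons_val_one, Matrix.cons_val_two, Matrix.head_cons,
    Matrix.tail_cons]
  field_simp
  ring

/-- **THREE-POINT CERTIFICATE: `χ²(b, z) ≥ (x₁ − x₀)²(x₂ − x₁)²(z₁₂ − z₀₁)² / Σ cᵢ²/wᵢ`** for every line `(b, z)`
(positive weights, distinct abscissae). -/
theorem threePoint_fitChiSq_ge (hw : ∀ i, 0 < w i) (h01 : x 0 ≠ x 1) (h12 : x 1 ≠ x 2) (b z : ℝ) :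
    ((x 1 - x 0) * (x 2 - x 1) * ((y 2 - y 1) / (x 2 - x 1) - (y 1 - y 0) / (x 1 - x 0))) ^ 2 /
        (∑ i, (![x 2 - x 1, -(x 2 - x 0), x 1 - x 0] i) ^ 2 / w i) ≤
      fitChiSq Finset.univ w x y b z := by
  rw [← threePoint_annihilator_eq x y h01 h12]
  refine fitChiSq_ge_annihilator Finset.univ w x y (fun i _ => hw i) _ (threePoint_annihilator_sum x)
    (threePoint_annihilator_sum_mul x) ?_ b z
  -- `Σ cᵢ²/wᵢ > 0`: the last coefficient `x₁ − x₀ ≠ 0`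
  have h1 : x 1 - x 0 ≠ 0 := sub_ne_zero.2 (Ne.symm h01)
  have hterm : 0 < (![x 2 - x 1, -(x 2 - x 0), x 1 - x 0] 2) ^ 2 / w 2 := by
    simp only [Matrix.cons_val_two, Matrix.tail_cons, Matrix.head_cons]
    exact div_pos (by positivity) (hw 2)
  exact lt_of_lt_of_le hterm (Finset.single_le_sum (f := fun i => (![x 2 - x 1, -(x 2 - x 0), x 1 - x 0] i) ^ 2 / w i)
    (fun i _ => div_nonneg (sq_nonneg _) (hw i).le) (Finset.mem_univ 2))

end Three

end Summit.Ventures.LatticeQCDFlow.Scoring
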